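import Literature.NumberTheory.EllipticCurves.ThreeTorsionCentralInvolutionSwanProofs
import Literature.NumberTheory.GaloisRepresentations.CentralInvolutionLayerProofs
import HarnessLib

/-!
# The wild inertia of `K(x(E[3]))` above `2` on the four `x`-coordinates:
# `#Q₀ · φ_{E/K}(b) = b + Σ_{j=2}^{4} (m_j - n)` and `Sw_𝔓(E[3])` from root data

`Proofs` file (theorems only, no definitions, no named facts) in topic
`NumberTheory/EllipticCurves`, sequel of `ThreeTorsionCentralInvolutionSwanProofs` and of
`CentralInvolutionLayerProofs` (`GaloisRepresentations`), landed by the seat of bsd.S15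
(`Literature.NumberTheory.EllipticCurves.conductorNorm_eq_artinConductorNat_of_isElliptic`) as the
evaluation step of the type-free Galois side of Ogg's formula above `2` (Silverman *ATAEC*
Thm. IV.11.1, `p = 2`, PDF p. 366): after `Sw_𝔓(E[3]) = 2 φ_{E/K}(b)` with `E = K(x(E[3]))`
(`swanConductorAt_torsion_eq_two_mul_herbrandPhi_quotient`), the number `#Q₀ · φ_{E/K}(b)` is
`b + Σ_{τ ∈ Q₁ ∖ 1} (i_Q(τ) - 1)` (`card_mul_herbrandPhi_eq_of_lowerIndex_eq_of_wild`), and this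
file computes the sum over the wild inertia group `Q₁` of `Gal(E/K)` at `𝔓 ∩ E` **without
constructing any automorphism**, from the action on the four `x`-coordinates `x₁, …, x₄` of
`E[3] ∖ O`:

* `forall_smul_geomTorsion_eq_of_restrict_mem_ramificationSubgroup_one` — a `σ ∈ Γ_K` with
  `σ|_L ∈ G₁(𝔓 ∩ L)`, `L = K(E[3])`, fixing one non-zero point of `E[3]` fixes `E[3]`
  (the Weil-pairing dichotomy `forall_smul_geomTorsion_eq_of_smul_eq_of_ne_zero`);
* `absRestrictNormalHom_eq_one_of_restrict_mem_of_smul_x_eq` — **a wild inertia element of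
  `E = K(x(E[3]))` fixing one `x`-coordinate is trivial**: `σx(T) = x(T)` gives `σT = ±T`, and
  `σ` or `ι⁻¹σ` is then trivial on `E[3]`; so `Q₁` acts freely on `{x₁, x₂, x₃, x₄}` and
  **`τ ↦ τx₁` is a bijection `Q₁ ∖ 1 → {x₂, x₃, x₄}` when `#Q₁ = 4`** (the image of the
  quaternion group `G₁` in `PSL₂(𝔽₃) ≅ A₄` is the four-group of double transpositions);
* `card_mul_herbrandPhi_eq_of_roots` — **`#Q₀ · φ_{E/K}(b) = b + Σ_{j=2}^{4} (m_j - n)`**: with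
  integral elements `Z, Z₂, Z₃, Z₄` of `E` such that every `σ` with `σx₁ = x_j` maps `Z` to
  `Z_j` (e.g. `Z = P(x₁)`, `Z_j = P(x_j)`, `P` a rational expression over `K`), `v_{𝔓_E}(Z) = n`
  odd and `v_{𝔓_E}(Z_j - Z) = m_j`, the element `τ_j ∈ Q₁` with `τ_j x₁ = x_j` has
  `τ_j Z - Z = Z_j - Z`, hence index `i_Q(τ_j) = m_j - n + 1` (`lowerIndex_eq_of_ord_smul_sub_eq`);
* `card_mul_swanConductorAt_torsion_eq_of_roots` — consequently
  **`#Q₀ · Sw_𝔓(E[3]) = 2 (b + Σ_{j=2}^{4} (m_j - n))`** with `b = i_{Gal(L/K)}(ι) - 1`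
  (`= v(2w) - v(w - t)`, `lowerIndex_eq_of_smul_eq_neg`).

So the wild conductor above `2` of an elliptic curve whose `3`-division field has quaternion wild
inertia (`#G₁ = 8`, `#Q₁ = 4`) is reduced to six valuations of explicit algebraic numbers:
`v(2w), v(w - t)` in `L` and `v(Z), v(Z₂ - Z), v(Z₃ - Z), v(Z₄ - Z)` in `E` (worked out in the
docstring of `card_mul_herbrandPhi_eq_of_roots` for `y² = x³ - x`: `Sw = 3`, `f₂ = 5`, `N = 32`).
(For `#Q₁ = 2` or `1` — cyclic or central wild inertia — the sum has one or no term and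
`card_mul_herbrandPhi_eq_of_lowerIndex_eq_of_wild` applies directly.)

## References

* J. H. Silverman, *Advanced Topics in the Arithmetic of Elliptic Curves*, GTM 151 (1994), §IV.10
  (Definition of `δ`, PDF p. 358), Thm. IV.11.1 (`p = 2`: p. 366). [SilvermanATAEC1994]
* J.-P. Serre, *Local Fields*, GTM 67 (1979), Ch. IV §§1–3. [SerreLocalFields1979]
* J. H. Silverman, *The Arithmetic of Elliptic Curves*, 2nd ed. (2009), III.2.3, III.8
  (Weil pairing), VIII.§1. [SilvermanAEC2009]

## Design

No definitions.  The fields `L ⊇ E` are parameters with the kernel hypotheses of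
`ThreeTorsionCentralInvolutionSwanProofs` (`hL`, `hLf`, `hι`, `hkerE`; discharged for
`divisionField`/`xDivisionField` by `DivisionField`), the test elements are elements of
`integralClosure (𝓞 K) E` given with their values in `K̄`.  `noncomputable section`; namespace
`WeierstrassCurve`; local instance `AddSubgroup.torsionBy.zmodModule`.  Axioms: `propext`,
`Classical.choice`, `Quot.sound`.
-/

noncomputable section

open scoped Classical NumberField
open Field IsDedekindDomain MeasureTheory

universe u

namespace WeierstrassCurve

open Literature.NumberTheory.EllipticCurves Literature.NumberTheory.GaloisRepresentations

attribute [local instance] AddSubgroup.torsionBy.zmodModule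

variable {K : Type u} [Field K] [NumberField K] (W : WeierstrassCurve K) (ℓ : ℕ) [Fact ℓ.Prime]

/-! ### Wild elements of the `ℓ`-division field fixing one point -/

/-- **A wild inertia element of `K(E[ℓ])` fixing one non-zero point of `E[ℓ]` fixes `E[ℓ]`.**
For `E/K` elliptic, `ℓ ∉ v`, `𝔓 ∣ v`, `L/K` finite normal through which the action on `E[ℓ]`
factors (`hL`), and `σ ∈ Γ_K` with `σ|_L ∈ G₁(𝔓 ∩ L)`: if `σT₀ = T₀` for some `T₀ ≠ O` then
`σ` fixes `E[ℓ]` pointwise — the subgroup `{ρ : ρ|_L ∈ G₁, ρT₀ = T₀}` fixes `μ_ℓ` (its elements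
are inertia elements times elements trivial on `L`), acts through a `p`-group, `p ≠ ℓ`, and
fixes `T₀`, so the Weil-pairing dichotomy `forall_smul_geomTorsion_eq_of_smul_eq_of_ne_zero`
applies.  [cite: SilvermanATAEC1994, proof of Thm. IV.11.1 (PDF p. 370)]
[cite: SerreLocalFields1979, Ch. IV §2 Cor. 3 of Prop. 7 and Ch. I §7 Prop. 22] -/
theorem forall_smul_geomTorsion_eq_of_restrict_mem_ramificationSubgroup_one [W.IsElliptic]
    {v : HeightOneSpectrum (𝓞 K)} (hℓ : (ℓ : 𝓞 K) ∉ v.asIdeal)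
    {𝔓 : Ideal (absIntegers (𝓞 K) K)} (h𝔓 : 𝔓 ∈ v.primesAbove)
    (L : IntermediateField K (AlgebraicClosure K)) [FiniteDimensional K L] [Normal K L]
    (hL : ∀ σ : absoluteGaloisGroup K, absRestrictNormalHom L σ = 1 →
      ∀ T : geomTorsion W ℓ, σ • T = T)
    {σ : absoluteGaloisGroup K}
    (hσ : absRestrictNormalHom L σ ∈
      (𝔓.comap (L.integralClosureToAbsIntegers (𝓞 K))).ramificationSubgroup (L ≃ₐ[K] L) 1)
    {T₀ : geomTorsion W ℓ} (hT₀ : T₀ ≠ 0) (hfix : σ • T₀ = T₀) :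
    ∀ T : geomTorsion W ℓ, σ • T = T := by
  have hprime : ℓ.Prime := Fact.out
  have hℓK : (ℓ : K) ≠ 0 := Nat.cast_ne_zero.mpr hprime.ne_zero
  haveI : 𝔓.IsPrime := h𝔓.1
  haveI : IsGalois K L := {}
  set G1 : Subgroup (L ≃ₐ[K] L) :=
    (𝔓.comap (L.integralClosureToAbsIntegers (𝓞 K))).ramificationSubgroup (L ≃ₐ[K] L) 1 with hG1
  -- the subgroup `H = {ρ : ρ|_L ∈ G₁, ρ T₀ = T₀}`
  set H : Subgroup (absoluteGaloisGroup K) :=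
    G1.comap (absRestrictNormalHom L) ⊓ MulAction.stabilizer (absoluteGaloisGroup K) T₀ with hH
  -- residue characteristic `p ≠ ℓ`; `G₁` is a `p`-group
  set p := ringChar (𝓞 K ⧸ v.asIdeal) with hp
  have hpprime : p.Prime := by
    haveI : Finite (𝓞 K ⧸ v.asIdeal) := Ideal.finiteQuotientOfFreeOfNeBot v.asIdeal v.ne_bot
    exact CharP.char_is_prime (𝓞 K ⧸ v.asIdeal) p
  have hpl : p ≠ ℓ := by
    intro hpl
    apply hℓ
    rw [← Ideal.Quotient.eq_zero_iff_mem, map_natCast, ← hpl]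
    exact ringChar.Nat.cast_ringChar
  haveI : Fact p.Prime := ⟨hpprime⟩
  have hG1p : IsPGroup p G1 := isPGroup_ramificationSubgroup_one_of_mem_primesAbove h𝔓 L
  -- `H` fixes `μ_ℓ`
  have hμ : ∀ ρ ∈ H, ∀ t : AlgebraicClosure K, t ^ ℓ = 1 → ρ • t = t := by
    intro ρ hρ t ht
    have hρ0 : absRestrictNormalHom L ρ ∈
        (𝔓.comap (L.integralClosureToAbsIntegers (𝓞 K))).inertia (L ≃ₐ[K] L) :=
      Ideal.ramificationSubgroup_le_inertia _ _ 1 (Subgroup.mem_comap.mp hρ.1)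
    obtain ⟨⟨ρ', hρ'I⟩, hρ'⟩ := inertia_comap_le_range_absRestrictNormalHom 𝔓 L hρ0
    rw [MonoidHom.comp_apply, Subgroup.subtype_apply] at hρ'
    have hτ : absRestrictNormalHom L ((ρ' : absoluteGaloisGroup K)⁻¹ * ρ) = 1 := by
      rw [map_mul, map_inv, hρ', inv_mul_cancel]
    have hτt : ((ρ' : absoluteGaloisGroup K)⁻¹ * ρ) • t = t :=
      W.smul_eq_self_of_pow_eq_one_of_forall_smul_geomTorsion_eq ℓ hℓK (hL _ hτ) ht
    have hρ't : (ρ' : absoluteGaloisGroup K) • t = t :=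
      smul_eq_self_of_mem_inertia_of_pow_prime_pow_eq_one (ℓ := ℓ) (n := 1) hℓ h𝔓 hρ'I
        (by rw [pow_one]; exact ht)
    calc ρ • t = ((ρ' : absoluteGaloisGroup K) * ((ρ' : absoluteGaloisGroup K)⁻¹ * ρ)) • t := by
          rw [mul_inv_cancel_left]
      _ = t := by rw [mul_smul, hτt, hρ't]
  -- `H` acts through elements of order prime to `ℓ`
  have hN : ∀ ρ ∈ H, ∃ N : ℕ, N.Coprime ℓ ∧ ∀ T : geomTorsion W ℓ, ρ ^ N • T = T := by
    intro ρ hρ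
    have hρ1 : absRestrictNormalHom L ρ ∈ G1 := Subgroup.mem_comap.mp hρ.1
    refine ⟨orderOf (absRestrictNormalHom L ρ), ?_, fun T ↦ hL _ ?_ T⟩
    · obtain ⟨k, hk⟩ := hG1p.exists_card_eq
      have hdvd : orderOf (absRestrictNormalHom L ρ) ∣ p ^ k :=
        hk ▸ Subgroup.orderOf_dvd_natCard _ hρ1
      exact Nat.Coprime.coprime_dvd_left hdvd
        (((Nat.coprime_primes hpprime hprime).mpr hpl).pow_left k)
    · rw [map_pow, pow_orderOf_eq_one]
  have hσH : σ ∈ H := ⟨Subgroup.mem_comap.mpr hσ, hfix⟩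
  exact W.forall_smul_geomTorsion_eq_of_smul_eq_of_ne_zero ℓ hℓK H hμ hN hT₀
    (fun ρ hρ => hρ.2) σ hσH

/-- **A wild inertia element of the `x`-coordinate field fixing one `x`-coordinate is trivial.**
In the setting of `ThreeTorsionCentralInvolutionSwanProofs` (`L` the `ℓ`-division field,
`ι` acting as `-1`, `E ≤ L` with `σ|_E = 1 ↔ σ|_L ∈ {1, ι}`), let `σ ∈ Γ_K` with
`σ|_L ∈ G₁(𝔓 ∩ L)`, `ι ∈ G₁(𝔓 ∩ L)`, and `σ x(T₀) = x(T₀)` for a point `T₀ = (x₀, y₀) ≠ O` of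
`E[ℓ]`.  Then `σ|_E = 1`: `σT₀ = ±T₀` (`smul_eq_or_smul_eq_neg_of_smul_x_eq`); if `σT₀ = T₀`
then `σ` is trivial on `E[ℓ]` (previous theorem), so `σ|_L = 1`; if `σT₀ = -T₀` the same
applies to `τ⁻¹σ`, `τ` a lift of `ι`, so `σ|_L = ι`.  Hence the wild inertia `Q₁` of `E` acts
freely on the `x`-coordinates of `E[ℓ] ∖ O`.  [cite: SilvermanAEC2009, III.2.3]
[cite: SilvermanATAEC1994, proof of Thm. IV.11.1 (PDF p. 370)] -/
theorem absRestrictNormalHom_eq_one_of_restrict_mem_of_smul_x_eq [W.IsElliptic]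
    {v : HeightOneSpectrum (𝓞 K)} (hℓ : (ℓ : 𝓞 K) ∉ v.asIdeal)
    {𝔓 : Ideal (absIntegers (𝓞 K) K)} (h𝔓 : 𝔓 ∈ v.primesAbove)
    (L : IntermediateField K (AlgebraicClosure K)) [FiniteDimensional K L] [Normal K L]
    (hL : ∀ σ : absoluteGaloisGroup K, absRestrictNormalHom L σ = 1 →
      ∀ T : geomTorsion W ℓ, σ • T = T)
    (hLf : ∀ σ : absoluteGaloisGroup K, (∀ T : geomTorsion W ℓ, σ • T = T) →
      absRestrictNormalHom L σ = 1)
    {ι : L ≃ₐ[K] L}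
    (hι : ∀ σ : absoluteGaloisGroup K, absRestrictNormalHom L σ = ι →
      ∀ T : geomTorsion W ℓ, σ • T = -T)
    (h1 : ι ∈ (𝔓.comap (L.integralClosureToAbsIntegers (𝓞 K))).ramificationSubgroup
      (L ≃ₐ[K] L) 1)
    (E : IntermediateField K (AlgebraicClosure K)) [Normal K E]
    (hkerE : ∀ σ : absoluteGaloisGroup K, absRestrictNormalHom E σ = 1 ↔
      absRestrictNormalHom L σ = 1 ∨ absRestrictNormalHom L σ = ι)
    {σ : absoluteGaloisGroup K}
    (hσ : absRestrictNormalHom L σ ∈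
      (𝔓.comap (L.integralClosureToAbsIntegers (𝓞 K))).ramificationSubgroup (L ≃ₐ[K] L) 1)
    {T₀ : geomTorsion W ℓ} {x₀ y₀ : AlgebraicClosure K}
    {h₀ : (W.baseChange (AlgebraicClosure K)).toAffine.Nonsingular x₀ y₀}
    (hT₀ : (T₀ : geomPoints W) = Affine.Point.some x₀ y₀ h₀) (hx : σ • x₀ = x₀) :
    absRestrictNormalHom E σ = 1 := by
  have hT₀0 : T₀ ≠ 0 := by
    intro h0
    have : (T₀ : geomPoints W) = 0 := by rw [h0]; rfl
    rw [hT₀] at this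
    exact absurd this.symm (by rintro ⟨⟩)
  rcases W.smul_eq_or_smul_eq_neg_of_smul_x_eq ℓ hT₀ hx with hfix | hneg
  · -- `σ T₀ = T₀`: `σ` fixes `E[ℓ]`, so `σ|_L = 1`
    have hall := W.forall_smul_geomTorsion_eq_of_restrict_mem_ramificationSubgroup_one ℓ hℓ h𝔓
      L hL hσ hT₀0 hfix
    exact (hkerE σ).mpr (Or.inl (hLf σ hall))
  · -- `σ T₀ = -T₀`: `τ⁻¹ σ` fixes `T₀`, `τ` a lift of `ι`
    obtain ⟨τ, hτ⟩ := absRestrictNormalHom_surjective' L ι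
    have hτneg := hι τ hτ
    have hfix : (τ⁻¹ * σ) • T₀ = T₀ := by
      rw [mul_smul, hneg, smul_neg, W.inv_smul_eq_neg_of_smul_eq_neg ℓ hτneg T₀, neg_neg]
    have hmem : absRestrictNormalHom L (τ⁻¹ * σ) ∈
        (𝔓.comap (L.integralClosureToAbsIntegers (𝓞 K))).ramificationSubgroup (L ≃ₐ[K] L) 1 := by
      rw [map_mul, map_inv, hτ]
      exact Subgroup.mul_mem _ (Subgroup.inv_mem _ h1) hσ
    have hall := W.forall_smul_geomTorsion_eq_of_restrict_mem_ramificationSubgroup_one ℓ hℓ h𝔓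
      L hL hmem hT₀0 hfix
    have h1' := hLf _ hall
    rw [map_mul, map_inv, hτ, inv_mul_eq_one] at h1'
    exact (hkerE σ).mpr (Or.inr h1'.symm)

/-! ### The four `x`-coordinates: `#Q₀ · φ_{E/K}(b)` from root data -/

set_option maxHeartbeats 800000 in
set_option synthInstance.maxHeartbeats 400000 in
/-- **`#Q₀ · φ_{E/K}(b) = b + Σ_{j=2}^{4} (m_j - n)` from root data.**  Setting of
`ThreeTorsionCentralInvolutionSwanProofs` at a prime `𝔓 ∣ v ∋ 2` for `ℓ = 3`: `L` the
`3`-division field (`hL`, `hLf`), `ι ∈ G₁(𝔓 ∩ L)` acting as `-1`, `E ≤ L` normal with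
`σ|_E = 1 ↔ σ|_L ∈ {1, ι}`, and `#Q₁(𝔓 ∩ E) = 4` (quaternion wild inertia).  Let
`x₁, x₂, x₃, x₄ ∈ K̄` (`x₂, x₃, x₄` distinct) contain the `x`-coordinate of every non-zero
point of `E[3]`, with `x₁ = x(T₁) ∈ E`; let `Z, Z₂, Z₃, Z₄ ∈ S_E = integralClosure (𝓞 K) E` be such that
every `σ ∈ Γ_K` with `σx₁ = x_j` maps `Z` to `Z_j` (e.g. `Z = P(x₁)`, `Z_j = P(x_j)` for a
rational expression `P` over `K`), with `v_{𝔓_E}(Z) = n` a unit mod `𝔓_E` (odd),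
`v_{𝔓_E}(Z_j - Z) = m_j` and `m_j - n ≤ b`.  Then
**`#Q₀ · φ_{E/K}(b) = b + (m₂ - n) + (m₃ - n) + (m₄ - n)`**.  Proof: `τ ∈ Q₁` maps `x₁` to some
`x_j` (`τ x₁ = x(τ T₁)`), to `x₁` only if `τ = 1`
(`absRestrictNormalHom_eq_one_of_restrict_mem_of_smul_x_eq` with
`absRestrictNormalHom_mem_ramificationSubgroup_one_iff_layer`), injectively; as `#Q₁ = 4`,
`τ ↦ τ x₁` is a bijection `Q₁ ∖ 1 → {x₂, x₃, x₄}`; and `τ Z - Z = Z_j - Z` gives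
`i_Q(τ) = m_j - n + 1` (`lowerIndex_eq_of_ord_smul_sub_eq`); conclude by
`card_mul_herbrandPhi_eq_of_lowerIndex_eq_of_wild`.  (Example: `y² = x³ - x` over `ℚ`,
`x₁² = 1 + 2/√3`, `x₂ = -x₁`, `x₃² = 1 - 2/√3`, `x₄ = -x₃`, `Z = x₁ - √3 = x₁ - 3(x₁² - 1)/2`:
`n = 3`, `m_j = 4`, `b = 3`, `#Q₀ = 4`, `φ = 3/2`, `Sw = 3`, `f₂ = 5`.)
[cite: SerreLocalFields1979, Ch. IV §1 (i_G), §3 Lemma 3 (p. 74)]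
[cite: SilvermanATAEC1994, §IV.10 Definition of δ (PDF p. 358), Thm. IV.11.1 p = 2 (p. 366)] -/
theorem card_mul_herbrandPhi_eq_of_roots [W.IsElliptic]
    {v : HeightOneSpectrum (𝓞 K)} (hv2 : (2 : 𝓞 K) ∈ v.asIdeal) (h3 : ((3 : ℕ) : 𝓞 K) ∉ v.asIdeal)
    {𝔓 : Ideal (absIntegers (𝓞 K) K)} (h𝔓 : 𝔓 ∈ v.primesAbove)
    (L : IntermediateField K (AlgebraicClosure K)) [FiniteDimensional K L] [Normal K L]
    (hL : ∀ σ : absoluteGaloisGroup K, absRestrictNormalHom L σ = 1 →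
      ∀ T : geomTorsion W (3 : ℕ), σ • T = T)
    (hLf : ∀ σ : absoluteGaloisGroup K, (∀ T : geomTorsion W (3 : ℕ), σ • T = T) →
      absRestrictNormalHom L σ = 1)
    {ι : L ≃ₐ[K] L}
    (hι : ∀ σ : absoluteGaloisGroup K, absRestrictNormalHom L σ = ι →
      ∀ T : geomTorsion W (3 : ℕ), σ • T = -T)
    (h1 : ι ∈ (𝔓.comap (L.integralClosureToAbsIntegers (𝓞 K))).ramificationSubgroup
      (L ≃ₐ[K] L) 1)
    (E : IntermediateField K (AlgebraicClosure K)) [FiniteDimensional K E] [Normal K E]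
    (hle : E ≤ L)
    (hkerE : ∀ σ : absoluteGaloisGroup K, absRestrictNormalHom E σ = 1 ↔
      absRestrictNormalHom L σ = 1 ∨ absRestrictNormalHom L σ = ι)
    (hcard : Nat.card ((𝔓.comap (E.integralClosureToAbsIntegers (𝓞 K))).ramificationSubgroup
      (E ≃ₐ[K] E) 1) = 4)
    {x₁ x₂ x₃ x₄ : AlgebraicClosure K} (h23 : x₂ ≠ x₃) (h24 : x₂ ≠ x₄) (h34 : x₃ ≠ x₄)
    (hroots : ∀ (T : geomTorsion W (3 : ℕ)) (x y : AlgebraicClosure K)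
      (h : (W.baseChange (AlgebraicClosure K)).toAffine.Nonsingular x y),
      (T : geomPoints W) = Affine.Point.some x y h → x = x₁ ∨ x = x₂ ∨ x = x₃ ∨ x = x₄)
    {T₁ : geomTorsion W (3 : ℕ)} {y₁ : AlgebraicClosure K}
    {hns₁ : (W.baseChange (AlgebraicClosure K)).toAffine.Nonsingular x₁ y₁}
    (hT₁ : (T₁ : geomPoints W) = Affine.Point.some x₁ y₁ hns₁) (hx₁E : x₁ ∈ E)
    {Z Z₂ Z₃ Z₄ : integralClosure (𝓞 K) E}
    (hZ₂ : ∀ σ : absoluteGaloisGroup K, σ • x₁ = x₂ →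
      σ • ((Z : E) : AlgebraicClosure K) = ((Z₂ : E) : AlgebraicClosure K))
    (hZ₃ : ∀ σ : absoluteGaloisGroup K, σ • x₁ = x₃ →
      σ • ((Z : E) : AlgebraicClosure K) = ((Z₃ : E) : AlgebraicClosure K))
    (hZ₄ : ∀ σ : absoluteGaloisGroup K, σ • x₁ = x₄ →
      σ • ((Z : E) : AlgebraicClosure K) = ((Z₄ : E) : AlgebraicClosure K))
    {n m₂ m₃ m₄ b : ℕ}
    (hn : ord (𝔓.comap (E.integralClosureToAbsIntegers (𝓞 K))) Z = n)
    (hnu : (n : integralClosure (𝓞 K) E) ∉ 𝔓.comap (E.integralClosureToAbsIntegers (𝓞 K)))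
    (hm₂ : ord (𝔓.comap (E.integralClosureToAbsIntegers (𝓞 K))) (Z₂ - Z) = m₂)
    (hm₃ : ord (𝔓.comap (E.integralClosureToAbsIntegers (𝓞 K))) (Z₃ - Z) = m₃)
    (hm₄ : ord (𝔓.comap (E.integralClosureToAbsIntegers (𝓞 K))) (Z₄ - Z) = m₄)
    (hm₂b : m₂ - n ≤ b) (hm₃b : m₃ - n ≤ b) (hm₄b : m₄ - n ≤ b) :
    (Nat.card ((𝔓.comap (E.integralClosureToAbsIntegers (𝓞 K))).ramificationSubgroup
        (E ≃ₐ[K] E) 0) : ℝ) *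
        herbrandPhi (𝔓.comap (E.integralClosureToAbsIntegers (𝓞 K))) (E ≃ₐ[K] E) b =
      b + (((m₂ - n) + (m₃ - n) + (m₄ - n) : ℕ) : ℝ) := by
  haveI : Fact (Nat.Prime 3) := ⟨Nat.prime_three⟩
  haveI hDD : IsDedekindDomain (integralClosure (𝓞 K) E) :=
    integralClosure.isDedekindDomain (𝓞 K) K E
  haveI : 𝔓.IsPrime := h𝔓.1
  haveI h𝔓max : 𝔓.IsMaximal := HeightOneSpectrum.isMaximal_of_mem_primesAbove h𝔓
  haveI : IsGalois K L := {}
  haveI : IsGalois K E := {}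
  haveI hPEmax : (𝔓.comap (E.integralClosureToAbsIntegers (𝓞 K))).IsMaximal := isMaximal_comap_integralClosureToAbsIntegers (𝓞 K) 𝔓 E
  -- `𝔓 ∩ E ≠ 0` (it lies over `v ∋ 2`)
  have hunder : (𝔓.comap (E.integralClosureToAbsIntegers (𝓞 K))).under (𝓞 K) = v.asIdeal := by
    rw [under_comap_integralClosureToAbsIntegers, ← h𝔓.2.over]
  have h2under : (2 : 𝓞 K) ∈ (𝔓.comap (E.integralClosureToAbsIntegers (𝓞 K))).under (𝓞 K) := by rw [hunder]; exact hv2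
  have hPE0 : (𝔓.comap (E.integralClosureToAbsIntegers (𝓞 K))) ≠ ⊥ := by
    intro h0
    have hinj : Function.Injective (algebraMap (𝓞 K) (integralClosure (𝓞 K) E)) :=
      (faithfulSMul_iff_algebraMap_injective _ _).mp
        (faithfulSMul_integralClosure (𝓞 K) (K := K) (L := E))
    have h2' := h2under
    rw [Ideal.under_def, Ideal.mem_comap, h0, Ideal.mem_bot] at h2'
    exact two_ne_zero (hinj (h2'.trans (map_zero _).symm))
  -- finite residue field of `𝔓 ∩ E`
  haveI hfinq : Finite (integralClosure (𝓞 K) E ⧸ (𝔓.comap (E.integralClosureToAbsIntegers (𝓞 K)))) := by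
    have hmodfin : Module.Finite (𝓞 K) (integralClosure (𝓞 K) E) :=
      IsIntegralClosure.finite (𝓞 K) K E (integralClosure (𝓞 K) E)
    have hlies : (𝔓.comap (E.integralClosureToAbsIntegers (𝓞 K))).LiesOver (𝔓.under (𝓞 K)) :=
      ⟨(under_comap_integralClosureToAbsIntegers (𝓞 K) 𝔓 E).symm⟩
    haveI : Finite ((𝓞 K) ⧸ 𝔓.under (𝓞 K)) := by
      rw [← h𝔓.2.over]; exact Ideal.finiteQuotientOfFreeOfNeBot v.asIdeal v.ne_bot
    haveI : Module.Finite ((𝓞 K) ⧸ 𝔓.under (𝓞 K)) (integralClosure (𝓞 K) E ⧸ (𝔓.comap (E.integralClosureToAbsIntegers (𝓞 K)))) :=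
      @module_finite_of_liesOver (𝓞 K) (integralClosure (𝓞 K) E) _ _ _ (𝔓.comap (E.integralClosureToAbsIntegers (𝓞 K))) (𝔓.under (𝓞 K))
        hlies hmodfin
    exact Module.finite_of_finite ((𝓞 K) ⧸ 𝔓.under (𝓞 K))
  -- restriction and values
  have hres : ∀ (σ : absoluteGaloisGroup K) (X : integralClosure (𝓞 K) E),
      (((absRestrictNormalHom E σ • X : integralClosure (𝓞 K) E) : E) : AlgebraicClosure K) =
        σ • ((X : E) : AlgebraicClosure K) := by
    intro σ X
    rw [integralClosure.coe_smul]
    exact AlgEquiv.restrictNormal_commutes (absoluteGaloisGroup.toAlgEquiv K σ) E X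
  have hresx : ∀ σ : absoluteGaloisGroup K,
      ((absRestrictNormalHom E σ ⟨x₁, hx₁E⟩ : E) : AlgebraicClosure K) = σ • x₁ :=
    fun σ => AlgEquiv.restrictNormal_commutes (absoluteGaloisGroup.toAlgEquiv K σ) E ⟨x₁, hx₁E⟩
  have hinjval : ∀ {X Y : integralClosure (𝓞 K) E},
      ((X : E) : AlgebraicClosure K) = ((Y : E) : AlgebraicClosure K) → X = Y :=
    fun h => Subtype.ext (Subtype.ext h)
  -- wild elements lift to wild elements
  have hlift : ∀ τ ∈ ((𝔓.comap (E.integralClosureToAbsIntegers (𝓞 K))).ramificationSubgroup (E ≃ₐ[K] E) 1), ∀ σ : absoluteGaloisGroup K, absRestrictNormalHom E σ = τ →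
      absRestrictNormalHom L σ ∈
        (𝔓.comap (L.integralClosureToAbsIntegers (𝓞 K))).ramificationSubgroup (L ≃ₐ[K] L) 1 := by
    intro τ hτ σ hσ
    rw [absRestrictNormalHom_mem_ramificationSubgroup_one_iff_layer L E h𝔓 hle hkerE h1 σ, hσ]
    exact hτ
  -- (b) `τ x₁ ∈ {x₁, x₂, x₃, x₄}`
  have himage : ∀ τ : E ≃ₐ[K] E, ((τ ⟨x₁, hx₁E⟩ : E) : AlgebraicClosure K) = x₁ ∨
      ((τ ⟨x₁, hx₁E⟩ : E) : AlgebraicClosure K) = x₂ ∨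
      ((τ ⟨x₁, hx₁E⟩ : E) : AlgebraicClosure K) = x₃ ∨
      ((τ ⟨x₁, hx₁E⟩ : E) : AlgebraicClosure K) = x₄ := by
    intro τ
    obtain ⟨σ, rfl⟩ := absRestrictNormalHom_surjective' E τ
    rw [hresx σ]
    have hval : ((σ • T₁ : geomTorsion W (3 : ℕ)) : geomPoints W) =
        Affine.Point.map ((show AlgebraicClosure K ≃ₐ[K] AlgebraicClosure K from σ) :
          AlgebraicClosure K →ₐ[K] AlgebraicClosure K) (Affine.Point.some x₁ y₁ hns₁) := by
      rw [← hT₁]; rfl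
    rw [Affine.Point.map_some] at hval
    exact hroots (σ • T₁) _ _ _ hval
  -- (c) a wild `τ ≠ 1` moves `x₁`
  have hmove : ∀ τ ∈ ((𝔓.comap (E.integralClosureToAbsIntegers (𝓞 K))).ramificationSubgroup (E ≃ₐ[K] E) 1), ((τ ⟨x₁, hx₁E⟩ : E) : AlgebraicClosure K) = x₁ → τ = 1 := by
    intro τ hτ hfix
    obtain ⟨σ, rfl⟩ := absRestrictNormalHom_surjective' E τ
    rw [hresx σ] at hfix
    exact W.absRestrictNormalHom_eq_one_of_restrict_mem_of_smul_x_eq 3 h3 h𝔓 L hL hLf hι h1 E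
      hkerE (hlift _ hτ σ rfl) hT₁ hfix
  -- (d) the index of `τ ∈ Q₁` with `τ x₁ = x_j`
  have hindex : ∀ τ ∈ ((𝔓.comap (E.integralClosureToAbsIntegers (𝓞 K))).ramificationSubgroup (E ≃ₐ[K] E) 1), ∀ {Zj : integralClosure (𝓞 K) E} {xj : AlgebraicClosure K} {m : ℕ},
      (∀ σ : absoluteGaloisGroup K, σ • x₁ = xj →
        σ • ((Z : E) : AlgebraicClosure K) = ((Zj : E) : AlgebraicClosure K)) →
      ((τ ⟨x₁, hx₁E⟩ : E) : AlgebraicClosure K) = xj →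
      ord (𝔓.comap (E.integralClosureToAbsIntegers (𝓞 K))) (Zj - Z) = m → n ≤ m ∧ lowerIndex (𝔓.comap (E.integralClosureToAbsIntegers (𝓞 K))) (E ≃ₐ[K] E) τ = ((m - n : ℕ) : ℕ∞) + 1 := by
    intro τ hτ Zj xj m hZj hτx hm
    obtain ⟨σ, rfl⟩ := absRestrictNormalHom_surjective' E τ
    rw [hresx σ] at hτx
    have hτZ : absRestrictNormalHom E σ • Z = Zj := by
      apply hinjval
      rw [hres σ Z]
      exact hZj σ hτx
    have hm' : ord (𝔓.comap (E.integralClosureToAbsIntegers (𝓞 K))) (absRestrictNormalHom E σ • Z - Z) = m := by rw [hτZ, hm]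
    exact @lowerIndex_eq_of_ord_smul_sub_eq (integralClosure (𝓞 K) E) _ hDD (E ≃ₐ[K] E) _ _
      (𝔓.comap (E.integralClosureToAbsIntegers (𝓞 K))) hPEmax hfinq hPE0 _ hτ Z m n hm' hn hnu
  -- the finset `T = Q₁ ∖ 1` and the index function
  haveI : Fintype (E ≃ₐ[K] E) := Fintype.ofFinite _
  set T : Finset (E ≃ₐ[K] E) := (Finset.univ.filter (fun τ => τ ∈ ((𝔓.comap (E.integralClosureToAbsIntegers (𝓞 K))).ramificationSubgroup (E ≃ₐ[K] E) 1))).erase 1 with hTdef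
  have hT : ∀ τ, τ ∈ T ↔ τ ∈ ((𝔓.comap (E.integralClosureToAbsIntegers (𝓞 K))).ramificationSubgroup (E ≃ₐ[K] E) 1) ∧ τ ≠ 1 := by
    intro τ
    simp only [hTdef, Finset.mem_erase, Finset.mem_filter, Finset.mem_univ, true_and]
    tauto
  set ξ : (E ≃ₐ[K] E) → AlgebraicClosure K := fun τ => ((τ ⟨x₁, hx₁E⟩ : E) : AlgebraicClosure K)
    with hξ
  set f : (E ≃ₐ[K] E) → ℕ := fun τ =>
    if ξ τ = x₂ then m₂ - n + 1 else if ξ τ = x₃ then m₃ - n + 1 else m₄ - n + 1 with hf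
  have hfval : ∀ τ ∈ T, lowerIndex (𝔓.comap (E.integralClosureToAbsIntegers (𝓞 K))) (E ≃ₐ[K] E) τ = f τ := by
    intro τ hτT
    obtain ⟨hτ, hτ1⟩ := (hT τ).mp hτT
    rcases himage τ with h | h | h | h
    · exact absurd (hmove τ hτ h) hτ1
    · simp only [hf, hξ, h, if_true]; push_cast; exact (hindex τ hτ hZ₂ h hm₂).2
    · simp only [hf, hξ, h, h23.symm, if_false, if_true]; push_cast
      exact (hindex τ hτ hZ₃ h hm₃).2
    · simp only [hf, hξ, h, h24.symm, h34.symm, if_false]; push_cast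
      exact (hindex τ hτ hZ₄ h hm₄).2
  have hfle : ∀ τ ∈ T, f τ ≤ b + 1 := by
    intro τ _
    simp only [hf]
    split_ifs <;> omega
  -- Lemma 3 evaluated on the wild elements
  have hmain := card_mul_herbrandPhi_eq_of_lowerIndex_eq_of_wild (𝔓.comap (E.integralClosureToAbsIntegers (𝓞 K))) T hT f hfval hfle
  rw [hmain]
  congr 1
  -- `Σ_{τ ∈ T} (f τ - 1) = (m₂ - n) + (m₃ - n) + (m₄ - n)` along the bijection `τ ↦ τ x₁`
  set g : AlgebraicClosure K → ℝ := fun x =>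
    if x = x₂ then ((m₂ - n : ℕ) : ℝ) else if x = x₃ then ((m₃ - n : ℕ) : ℝ) else ((m₄ - n : ℕ) : ℝ)
    with hg
  have hfg : ∀ τ ∈ T, ((f τ : ℝ) - 1) = g (ξ τ) := by
    intro τ hτT
    obtain ⟨hτ, hτ1⟩ := (hT τ).mp hτT
    rcases himage τ with h | h | h | h
    · exact absurd (hmove τ hτ h) hτ1
    · simp only [hf, hg, hξ, h, if_true]; push_cast; ring
    · simp only [hf, hg, hξ, h, h23.symm, if_false, if_true]; push_cast; ring
    · simp only [hf, hg, hξ, h, h24.symm, h34.symm, if_false]; push_cast; ring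
  rw [Finset.sum_congr rfl hfg]
  -- injectivity of `τ ↦ τ x₁` on `T`
  have hinj : Set.InjOn ξ ↑T := by
    intro τ hτ τ' hτ' hX
    have hτQ : τ ∈ ((𝔓.comap (E.integralClosureToAbsIntegers (𝓞 K))).ramificationSubgroup (E ≃ₐ[K] E) 1) := ((hT τ).mp hτ).1
    have hτ'Q : τ' ∈ ((𝔓.comap (E.integralClosureToAbsIntegers (𝓞 K))).ramificationSubgroup (E ≃ₐ[K] E) 1) := ((hT τ').mp hτ').1
    have hfix : ξ (τ⁻¹ * τ') = x₁ := by
      have hX' : τ ⟨x₁, hx₁E⟩ = τ' ⟨x₁, hx₁E⟩ := Subtype.ext hX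
      simp only [hξ, AlgEquiv.mul_apply]
      rw [← hX', ← AlgEquiv.mul_apply, inv_mul_cancel, AlgEquiv.one_apply]
    have := hmove _ (Subgroup.mul_mem _ (Subgroup.inv_mem _ hτQ) hτ'Q) hfix
    rw [inv_mul_eq_one] at this
    exact this
  rw [← Finset.sum_image hinj]
  -- the image is `{x₂, x₃, x₄}`
  have hsub : T.image ξ ⊆ {x₂, x₃, x₄} := by
    intro x hxmem
    obtain ⟨τ, hτT, rfl⟩ := Finset.mem_image.mp hxmem
    obtain ⟨hτ, hτ1⟩ := (hT τ).mp hτT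
    simp only [Finset.mem_insert, Finset.mem_singleton]
    rcases himage τ with h | h | h | h
    · exact absurd (hmove τ hτ h) hτ1
    · exact Or.inl h
    · exact Or.inr (Or.inl h)
    · exact Or.inr (Or.inr h)
  have hcardT : T.card = 3 := by
    have hQ1card : (Finset.univ.filter (fun τ : E ≃ₐ[K] E => τ ∈ ((𝔓.comap (E.integralClosureToAbsIntegers (𝓞 K))).ramificationSubgroup (E ≃ₐ[K] E) 1))).card = 4 := by
      rw [← hcard, Nat.card_eq_fintype_card, ← Fintype.card_subtype]
    rw [hTdef, Finset.card_erase_of_mem (by simp), hQ1card]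
  have hcard3 : ({x₂, x₃, x₄} : Finset (AlgebraicClosure K)).card = 3 := by
    rw [Finset.card_insert_of_notMem (by simp [h23, h24]),
      Finset.card_insert_of_notMem (by simp [h34]), Finset.card_singleton]
  have himg : T.image ξ = {x₂, x₃, x₄} := by
    apply Finset.eq_of_subset_of_card_le hsub
    rw [hcard3, Finset.card_image_of_injOn hinj, hcardT]
  rw [himg, Finset.sum_insert (by simp [h23, h24]), Finset.sum_insert (by simp [h34]),
    Finset.sum_singleton, hg]
  simp only [if_true, h23.symm, h24.symm, h34.symm, if_false]
  push_cast
  ring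

/-- **`#Q₀ · Sw_𝔓(E[3]) = 2 (b + Σ_{j=2}^{4} (m_j - n))`** — the wild conductor above `2` of an
elliptic curve with quaternion wild inertia on `E[3]`, from root data: combine
`swanConductorAt_torsion_eq_two_mul_herbrandPhi_quotient` (`Sw = 2φ_{E/K}(b)`,
`b = i_{Gal(L/K)}(ι) - 1`) with `card_mul_herbrandPhi_eq_of_roots`.
[cite: SilvermanATAEC1994, §IV.10 Definition of δ (PDF p. 358), Thm. IV.11.1 p = 2 (p. 366)]
[cite: SerreLocalFields1979, Ch. IV §§1–3] -/
theorem card_mul_swanConductorAt_torsion_eq_of_roots [W.IsElliptic]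
    {v : HeightOneSpectrum (𝓞 K)} (hv2 : (2 : 𝓞 K) ∈ v.asIdeal) (h3 : ((3 : ℕ) : 𝓞 K) ∉ v.asIdeal)
    {𝔓 : Ideal (absIntegers (𝓞 K) K)} (h𝔓 : 𝔓 ∈ v.primesAbove)
    (L : IntermediateField K (AlgebraicClosure K)) [FiniteDimensional K L] [Normal K L]
    (hL : ∀ σ : absoluteGaloisGroup K, absRestrictNormalHom L σ = 1 →
      ∀ T : geomTorsion W (3 : ℕ), σ • T = T)
    (hLf : ∀ σ : absoluteGaloisGroup K, (∀ T : geomTorsion W (3 : ℕ), σ • T = T) →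
      absRestrictNormalHom L σ = 1)
    {ι : L ≃ₐ[K] L}
    (hι : ∀ σ : absoluteGaloisGroup K, absRestrictNormalHom L σ = ι →
      ∀ T : geomTorsion W (3 : ℕ), σ • T = -T)
    (h1 : ι ∈ (𝔓.comap (L.integralClosureToAbsIntegers (𝓞 K))).ramificationSubgroup
      (L ≃ₐ[K] L) 1)
    {b : ℕ} (hb : lowerIndex (𝔓.comap (L.integralClosureToAbsIntegers (𝓞 K))) (L ≃ₐ[K] L) ι =
      b + 1)
    (E : IntermediateField K (AlgebraicClosure K)) [FiniteDimensional K E] [Normal K E]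
    (hle : E ≤ L)
    (hkerE : ∀ σ : absoluteGaloisGroup K, absRestrictNormalHom E σ = 1 ↔
      absRestrictNormalHom L σ = 1 ∨ absRestrictNormalHom L σ = ι)
    (hcard : Nat.card ((𝔓.comap (E.integralClosureToAbsIntegers (𝓞 K))).ramificationSubgroup
      (E ≃ₐ[K] E) 1) = 4)
    {x₁ x₂ x₃ x₄ : AlgebraicClosure K} (h23 : x₂ ≠ x₃) (h24 : x₂ ≠ x₄) (h34 : x₃ ≠ x₄)
    (hroots : ∀ (T : geomTorsion W (3 : ℕ)) (x y : AlgebraicClosure K)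
      (h : (W.baseChange (AlgebraicClosure K)).toAffine.Nonsingular x y),
      (T : geomPoints W) = Affine.Point.some x y h → x = x₁ ∨ x = x₂ ∨ x = x₃ ∨ x = x₄)
    {T₁ : geomTorsion W (3 : ℕ)} {y₁ : AlgebraicClosure K}
    {hns₁ : (W.baseChange (AlgebraicClosure K)).toAffine.Nonsingular x₁ y₁}
    (hT₁ : (T₁ : geomPoints W) = Affine.Point.some x₁ y₁ hns₁) (hx₁E : x₁ ∈ E)
    {Z Z₂ Z₃ Z₄ : integralClosure (𝓞 K) E}
    (hZ₂ : ∀ σ : absoluteGaloisGroup K, σ • x₁ = x₂ →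
      σ • ((Z : E) : AlgebraicClosure K) = ((Z₂ : E) : AlgebraicClosure K))
    (hZ₃ : ∀ σ : absoluteGaloisGroup K, σ • x₁ = x₃ →
      σ • ((Z : E) : AlgebraicClosure K) = ((Z₃ : E) : AlgebraicClosure K))
    (hZ₄ : ∀ σ : absoluteGaloisGroup K, σ • x₁ = x₄ →
      σ • ((Z : E) : AlgebraicClosure K) = ((Z₄ : E) : AlgebraicClosure K))
    {n m₂ m₃ m₄ : ℕ}
    (hn : ord (𝔓.comap (E.integralClosureToAbsIntegers (𝓞 K))) Z = n)
    (hnu : (n : integralClosure (𝓞 K) E) ∉ 𝔓.comap (E.integralClosureToAbsIntegers (𝓞 K)))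
    (hm₂ : ord (𝔓.comap (E.integralClosureToAbsIntegers (𝓞 K))) (Z₂ - Z) = m₂)
    (hm₃ : ord (𝔓.comap (E.integralClosureToAbsIntegers (𝓞 K))) (Z₃ - Z) = m₃)
    (hm₄ : ord (𝔓.comap (E.integralClosureToAbsIntegers (𝓞 K))) (Z₄ - Z) = m₄)
    (hm₂b : m₂ - n ≤ b) (hm₃b : m₃ - n ≤ b) (hm₄b : m₄ - n ≤ b) :
    (Nat.card ((𝔓.comap (E.integralClosureToAbsIntegers (𝓞 K))).ramificationSubgroup
        (E ≃ₐ[K] E) 0) : ℝ) * (W.torsionGaloisRep 3).swanConductorAt (𝓞 K) 𝔓 =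
      2 * (b + (((m₂ - n) + (m₃ - n) + (m₄ - n) : ℕ) : ℝ)) := by
  rw [W.swanConductorAt_torsion_eq_two_mul_herbrandPhi_quotient 3 hv2 h3 h𝔓 L hL hLf hι hb E hle
    hkerE]
  have key := W.card_mul_herbrandPhi_eq_of_roots hv2 h3 h𝔓 L hL hLf hι h1 E hle hkerE hcard
    h23 h24 h34 hroots hT₁ hx₁E hZ₂ hZ₃ hZ₄ hn hnu hm₂ hm₃ hm₄ hm₂b hm₃b hm₄b
  rw [mul_left_comm, key]

end WeierstrassCurve

end
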